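import Summits.Ventures.Crystal3D.Theorems.StickyWulffConstantTextureLiminfTexShadowLevelReachHexagonPooledFlux
import Summits.Ventures.Crystal3D.Theorems.StickyWulffConstantTextureLiminfTexShadowLevelReachHexagonPooledRoot
import HarnessLib

/-!
# Both plates' hexagon FLUX and lane T's payer currency — re-keyed to the ROOT-CLASS row
# (lane T, crux `TextureLiminfV5`, stmt-Ventures-23912, registered stub `stub_terraceCensus`; cf-p1 (ccc)(2)(i) / (ccci))

HONEST FRAMING. Venture `Summits/Ventures/Crystal3D` (cell `crystal3d-full`), route `route-Ventures-StickyWulffConstant`, helper `--supports` the law-v5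
crux `TextureLiminfV5` (stmt-Ventures-23912), lane T.  Census-free and certificate-free (the ROOT-CLASS local row `LocalEndRowRootA ver sF ⟨Fr, RT↑⟩ ⟨G₂, RT↓⟩`,
…EndRowRootDefs, is a HYPOTHESIS); nothing about energies; F-C1 not moved.

THE POINT.  `hexagon_twoPlate_flux_le_payers_cuts` / `hexagon_twoPlate_flux_le_payerSum` (…LevelReachHexagonPooledFlux, 19480-p1 g23, p748129) VERBATIM — same
statements, same proofs — with the row hypothesis WEAKENED from lane F's `LocalEndRowA` to the root-class row `LocalEndRowRootA` (the weakest sufficient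
joint row of the (β) plates side, cf-p1 (ccc)(2)(i); `localEndRowRootA_of_localEndRowA`), keyed to `hexagon_twoPlate_sources_le_payers_cuts_root`
(…LevelReachHexagonPooledRoot); the row-independent bookkeeping (`topPlate_flux_le_sources`, `card_band_annulus₃_le/₂_le`, `widenedPayerSum_le`) is imported:
* **`hexagon_twoPlate_flux_le_payers_cuts_root`** — both LHS = lane F fluxes (`oneFcc_srcA_ge` below, its mirrored transport above);
* **`hexagon_twoPlate_flux_le_payerSum_root`** — `flux₁(Kw₁) + flux₂(Kw₂) ≤ sF·Σ_PAY(12 − deg) + ΣCUT₁ + ΣCUT₂ + (3456·sF + 1710720)·ρ` in lane T's payer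
  currency `PAY = {deg ≠ 12, −R₀−2 ≤ y₂ ≤ h+R₀+2}`.
WHAT THIS IS NOT: the row, the flux-to-area evaluation, the born-line families, any certificate; F-C1 not moved.
-/

noncomputable section

namespace Summit.Ventures.Crystal3D.Theorems

open Summit.Ventures.Crystal3D Finset
open Literature.MathematicalPhysics.StatisticalMechanics (barlowPos barlowStacking IsHaggSeq barlowPos_mem basalMirror
  basalMirror_apply_coord basalMirror_basalMirror)
open Summit.Ventures.Crystal3D.Cruxes.TextureLiminf.TexShadow (E3 stacking)
open scoped InnerProductSpace

open scoped Classical in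
/-- **Both plates' hexagon FLUX under ONE ROOT-CLASS local row.**  See the module docstring. -/
theorem hexagon_twoPlate_flux_le_payers_cuts_root (ver : WordVersion) {δ : ℝ} (hg : KissingGap δ) (hc : KissingClassification δ)
    {σ₁ σ₂ : ℤ → ℤ} (hσ₁ : IsHaggSeq σ₁) (hσ₂ : IsHaggSeq σ₂) (L₁ L₂ : E3 ≃ₗᵢ[ℝ] E3) (s₁ s₂ : E3)
    (Fr : E3 ≃ₗᵢ[ℝ] E3) {t : ℤ} (hFr : (t = 1 ∧ Fr = L₁) ∨ (t = -1 ∧ Fr = basalMirror.trans L₁))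
    (G₂ : E3 ≃ₗᵢ[ℝ] E3) {t' : ℤ} (hG₂ : (t' = 1 ∧ G₂ = L₂) ∨ (t' = -1 ∧ G₂ = basalMirror.trans L₂))
    (hne₁ : (Fr : E3 → E3) '' ↑fccSlots ≠ (L₂ : E3 → E3) '' ↑fccSlots)
    (hne₂ : (Fr : E3 → E3) '' ↑fccSlots ≠ ((basalMirror.trans L₂ : E3 ≃ₗᵢ[ℝ] E3) : E3 → E3) '' ↑fccSlots)
    (hne₁' : (G₂ : E3 → E3) '' ↑fccSlots ≠ (L₁ : E3 → E3) '' ↑fccSlots)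
    (hne₂' : (G₂ : E3 → E3) '' ↑fccSlots ≠ ((basalMirror.trans L₁ : E3 ≃ₗᵢ[ℝ] E3) : E3 → E3) '' ↑fccSlots)
    {sF : ℝ} (hrow : LocalEndRowRootA ver sF ⟨Fr, inPlaneRoots Fr 1⟩ ⟨G₂, inPlaneRoots G₂ (-1)⟩)
    (X P₁ P₂ : Finset E3) (R₀ h ρ : ℝ) (hR₀ : 5 ≤ R₀) (hh : 0 ≤ h) (hρ : R₀ + 2 ≤ ρ)
    (hX : ∀ p ∈ X, ∀ q ∈ X, p ≠ q → 1 ≤ dist p q) (hP₁X : P₁ ⊆ X) (hP₂X : P₂ ⊆ X)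
    (hP₁ : ∀ p, p ∈ P₁ ↔ (p ∈ stacking L₁ s₁ σ₁ ∧ -(2 * R₀) ≤ p 2 ∧ p 2 ≤ -R₀ ∧ p 0 ^ 2 + p 1 ^ 2 ≤ ρ ^ 2))
    (hP₂ : ∀ p, p ∈ P₂ ↔ (p ∈ stacking L₂ s₂ σ₂ ∧ h + R₀ ≤ p 2 ∧ p 2 ≤ h + 2 * R₀ ∧ p 0 ^ 2 + p 1 ^ 2 ≤ ρ ^ 2))
    (Kw₁ Kw₂ : Finset ℤ) :
    ∑ k ∈ Kw₁, (if ¬ (σ₁ (k - 1) = -t ∧ σ₁ k = -t) then (1 : ℝ) else 0) *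
        (4 * (∑ r ∈ inPlaneRoots Fr 1, (Fr r) 2) / (Real.sqrt 3 * (1 - (L₁.symm (EuclideanSpace.single (2 : Fin 3) (1 : ℝ))) 2 ^ 2)) *
          Real.sqrt (max 0 ((ρ - 4) ^ 2 * (1 - (L₁.symm (EuclideanSpace.single (2 : Fin 3) (1 : ℝ))) 2 ^ 2) -
            ((k : ℝ) * Real.sqrt (2 / 3) + (L₁.symm s₁) 2 -
              (-(R₀ + 1) - 1) * (L₁.symm (EuclideanSpace.single (2 : Fin 3) (1 : ℝ))) 2) ^ 2)) -
          ((inPlaneRoots Fr 1).card : ℝ)) +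
      ∑ k ∈ Kw₂, (if ¬ (σ₂ (k - 1) = -t' ∧ σ₂ k = -t') then (1 : ℝ) else 0) *
        (4 * (∑ r ∈ inPlaneRoots G₂ (-1), -(G₂ r) 2) / (Real.sqrt 3 * (1 - (L₂.symm (EuclideanSpace.single (2 : Fin 3) (1 : ℝ))) 2 ^ 2)) *
          Real.sqrt (max 0 ((ρ - 4) ^ 2 * (1 - (L₂.symm (EuclideanSpace.single (2 : Fin 3) (1 : ℝ))) 2 ^ 2) -
            ((k : ℝ) * Real.sqrt (2 / 3) + (L₂.symm s₂) 2 -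
              (h + (R₀ + 1) + 1) * (L₂.symm (EuclideanSpace.single (2 : Fin 3) (1 : ℝ))) 2) ^ 2)) -
          ((inPlaneRoots G₂ (-1)).card : ℝ)) ≤
      sF * ∑ z ∈ X.filter (fun z => (X.filter fun q => dist z q = 1).card ≤ 11 ∧
          -(R₀ + 1) - 2 ≤ z 2 ∧ z 2 ≤ h + (R₀ + 1) + 2), ((12 : ℝ) - ((X.filter fun q => dist z q = 1).card : ℝ)) +
        ((∑ r ∈ inPlaneRoots Fr 1, (X.filter fun b => -(R₀ + 1) - 1 ≤ b 2 ∧ b 2 < h + (R₀ + 1) + 1 ∧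
            (∃ μ, ⟪r, μ⟫_ℝ = Real.sqrt (2 / 3) ∧ IsTwinReading X Fr (Fr μ) b) ∧ b - Fr r ∈ X).card : ℕ) : ℝ) +
        ((∑ r ∈ inPlaneRoots G₂ (-1), (X.filter fun b => -(R₀ + 1) - 1 < b 2 ∧ b 2 ≤ h + (R₀ + 1) + 1 ∧
            (∃ μ, ⟪r, μ⟫_ℝ = Real.sqrt (2 / 3) ∧ IsTwinReading X G₂ (G₂ μ) b) ∧ b - G₂ r ∈ X).card : ℕ) : ℝ) +
        ((inPlaneRoots Fr 1).card : ℝ) *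
          (220 * ((X.filter fun s => h + (R₀ + 1) + 1 ≤ s 2 ∧ s 2 ≤ h + (R₀ + 1) + 1 + 1 ∧
              (ρ - 1 - 2) ^ 2 < s 0 ^ 2 + s 1 ^ 2).card : ℝ) +
            220 * ((X.filter fun s => -(R₀ + 1) - 1 - 1 ≤ s 2 ∧ s 2 < -(R₀ + 1) - 1 ∧
              (ρ - 1 - 1) ^ 2 < s 0 ^ 2 + s 1 ^ 2).card : ℝ)) +
        ((inPlaneRoots G₂ (-1)).card : ℝ) *
          (220 * ((X.filter fun s => -(R₀ + 1) - 1 - 1 ≤ s 2 ∧ s 2 ≤ -(R₀ + 1) - 1 ∧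
              (ρ - 1 - 2) ^ 2 < s 0 ^ 2 + s 1 ^ 2).card : ℝ) +
            220 * ((X.filter fun s => h + (R₀ + 1) + 1 < s 2 ∧ s 2 ≤ h + (R₀ + 1) + 1 + 1 ∧
              (ρ - 1 - 1) ^ 2 < s 0 ^ 2 + s 1 ^ 2).card : ℝ)) := by
  have h0₁ := oneFcc_srcA_ge L₁ s₁ Fr (fun r hr => frame_apply_basal hFr hr) t P₁ R₀ h ρ (by linarith) hh (by linarith) hP₁ Kw₁
  have h0₂ := topPlate_flux_le_sources L₂ s₂ G₂ hG₂ P₂ R₀ h ρ (by linarith) hh (by linarith) hP₂ Kw₂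
  have h1 := hexagon_twoPlate_sources_le_payers_cuts_root ver hg hc hσ₁ hσ₂ L₁ L₂ s₁ s₂ Fr hFr G₂ hG₂ hne₁ hne₂ hne₁' hne₂' hrow X P₁ P₂
    R₀ h ρ hR₀ hρ hX hP₁X hP₂X hP₁ hP₂
  linarith only [h0₁, h0₂, h1]

open scoped Classical in
/-- **Both plates' hexagon flux in lane T's payer currency under the ROOT-CLASS row** (`sF ≥ 0`; the whole configuration in the cell cylinder).  See the module docstring. -/
theorem hexagon_twoPlate_flux_le_payerSum_root (ver : WordVersion) {δ : ℝ} (hg : KissingGap δ) (hc : KissingClassification δ)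
    {σ₁ σ₂ : ℤ → ℤ} (hσ₁ : IsHaggSeq σ₁) (hσ₂ : IsHaggSeq σ₂) (L₁ L₂ : E3 ≃ₗᵢ[ℝ] E3) (s₁ s₂ : E3)
    (Fr : E3 ≃ₗᵢ[ℝ] E3) {t : ℤ} (hFr : (t = 1 ∧ Fr = L₁) ∨ (t = -1 ∧ Fr = basalMirror.trans L₁))
    (G₂ : E3 ≃ₗᵢ[ℝ] E3) {t' : ℤ} (hG₂ : (t' = 1 ∧ G₂ = L₂) ∨ (t' = -1 ∧ G₂ = basalMirror.trans L₂))
    (hne₁ : (Fr : E3 → E3) '' ↑fccSlots ≠ (L₂ : E3 → E3) '' ↑fccSlots)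
    (hne₂ : (Fr : E3 → E3) '' ↑fccSlots ≠ ((basalMirror.trans L₂ : E3 ≃ₗᵢ[ℝ] E3) : E3 → E3) '' ↑fccSlots)
    (hne₁' : (G₂ : E3 → E3) '' ↑fccSlots ≠ (L₁ : E3 → E3) '' ↑fccSlots)
    (hne₂' : (G₂ : E3 → E3) '' ↑fccSlots ≠ ((basalMirror.trans L₁ : E3 ≃ₗᵢ[ℝ] E3) : E3 → E3) '' ↑fccSlots)
    {sF : ℝ} (hsF : 0 ≤ sF) (hrow : LocalEndRowRootA ver sF ⟨Fr, inPlaneRoots Fr 1⟩ ⟨G₂, inPlaneRoots G₂ (-1)⟩)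
    (X P₁ P₂ : Finset E3) (R₀ h ρ : ℝ) (hR₀ : 5 ≤ R₀) (hh : 0 ≤ h) (hρ : R₀ + 2 ≤ ρ)
    (hX : ∀ p ∈ X, ∀ q ∈ X, p ≠ q → 1 ≤ dist p q) (hP₁X : P₁ ⊆ X) (hP₂X : P₂ ⊆ X)
    (hcell : ∀ p ∈ X, -(2 * R₀) ≤ p 2 ∧ p 2 ≤ h + 2 * R₀ ∧ p 0 ^ 2 + p 1 ^ 2 ≤ ρ ^ 2)
    (hP₁ : ∀ p, p ∈ P₁ ↔ (p ∈ stacking L₁ s₁ σ₁ ∧ -(2 * R₀) ≤ p 2 ∧ p 2 ≤ -R₀ ∧ p 0 ^ 2 + p 1 ^ 2 ≤ ρ ^ 2))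
    (hP₂ : ∀ p, p ∈ P₂ ↔ (p ∈ stacking L₂ s₂ σ₂ ∧ h + R₀ ≤ p 2 ∧ p 2 ≤ h + 2 * R₀ ∧ p 0 ^ 2 + p 1 ^ 2 ≤ ρ ^ 2))
    (Kw₁ Kw₂ : Finset ℤ) :
    ∑ k ∈ Kw₁, (if ¬ (σ₁ (k - 1) = -t ∧ σ₁ k = -t) then (1 : ℝ) else 0) *
        (4 * (∑ r ∈ inPlaneRoots Fr 1, (Fr r) 2) / (Real.sqrt 3 * (1 - (L₁.symm (EuclideanSpace.single (2 : Fin 3) (1 : ℝ))) 2 ^ 2)) *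
          Real.sqrt (max 0 ((ρ - 4) ^ 2 * (1 - (L₁.symm (EuclideanSpace.single (2 : Fin 3) (1 : ℝ))) 2 ^ 2) -
            ((k : ℝ) * Real.sqrt (2 / 3) + (L₁.symm s₁) 2 -
              (-(R₀ + 1) - 1) * (L₁.symm (EuclideanSpace.single (2 : Fin 3) (1 : ℝ))) 2) ^ 2)) -
          ((inPlaneRoots Fr 1).card : ℝ)) +
      ∑ k ∈ Kw₂, (if ¬ (σ₂ (k - 1) = -t' ∧ σ₂ k = -t') then (1 : ℝ) else 0) *
        (4 * (∑ r ∈ inPlaneRoots G₂ (-1), -(G₂ r) 2) / (Real.sqrt 3 * (1 - (L₂.symm (EuclideanSpace.single (2 : Fin 3) (1 : ℝ))) 2 ^ 2)) *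
          Real.sqrt (max 0 ((ρ - 4) ^ 2 * (1 - (L₂.symm (EuclideanSpace.single (2 : Fin 3) (1 : ℝ))) 2 ^ 2) -
            ((k : ℝ) * Real.sqrt (2 / 3) + (L₂.symm s₂) 2 -
              (h + (R₀ + 1) + 1) * (L₂.symm (EuclideanSpace.single (2 : Fin 3) (1 : ℝ))) 2) ^ 2)) -
          ((inPlaneRoots G₂ (-1)).card : ℝ)) ≤
      sF * ∑ y ∈ X.filter (fun y => (X.filter fun q => dist y q = 1).card ≠ 12 ∧ -R₀ - 2 ≤ y 2 ∧ y 2 ≤ h + R₀ + 2),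
          ((12 : ℝ) - ((X.filter fun q => dist y q = 1).card : ℝ)) +
        ((∑ r ∈ inPlaneRoots Fr 1, (X.filter fun b => -(R₀ + 1) - 1 ≤ b 2 ∧ b 2 < h + (R₀ + 1) + 1 ∧
            (∃ μ, ⟪r, μ⟫_ℝ = Real.sqrt (2 / 3) ∧ IsTwinReading X Fr (Fr μ) b) ∧ b - Fr r ∈ X).card : ℕ) : ℝ) +
        ((∑ r ∈ inPlaneRoots G₂ (-1), (X.filter fun b => -(R₀ + 1) - 1 < b 2 ∧ b 2 ≤ h + (R₀ + 1) + 1 ∧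
            (∃ μ, ⟪r, μ⟫_ℝ = Real.sqrt (2 / 3) ∧ IsTwinReading X G₂ (G₂ μ) b) ∧ b - G₂ r ∈ X).card : ℕ) : ℝ) +
        (3456 * sF + 1710720) * ρ := by
  have hflux := hexagon_twoPlate_flux_le_payers_cuts_root ver hg hc hσ₁ hσ₂ L₁ L₂ s₁ s₂ Fr hFr G₂ hG₂ hne₁ hne₂ hne₁' hne₂' hrow X P₁ P₂
    R₀ h ρ hR₀ hh hρ hX hP₁X hP₂X hP₁ hP₂ Kw₁ Kw₂
  have hPAYW := widenedPayerSum_le hσ₁ hσ₂ L₁ L₂ s₁ s₂ hX hP₁X hP₂X hcell hP₁ hP₂ (by linarith) (by linarith)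
  have hmono := mul_le_mul_of_nonneg_left hPAYW hsF
  -- the four rims
  have hsepX : ∀ (S : Finset E3), S ⊆ X → ∀ p ∈ S, ∀ q ∈ S, p ≠ q → 1 ≤ dist p q :=
    fun S hS p hp q hq hpq => hX p (hS hp) q (hS hq) hpq
  have hrimT : ((X.filter fun s => h + (R₀ + 1) + 1 ≤ s 2 ∧ s 2 ≤ h + (R₀ + 1) + 1 + 1 ∧
      (ρ - 1 - 2) ^ 2 < s 0 ^ 2 + s 1 ^ 2).card : ℝ) ≤ 180 * ρ :=
    card_band_annulus₃_le _ (hsepX _ (filter_subset _ _)) (h + (R₀ + 1) + 1) ρ (by linarith)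
      (fun p hp => by
        obtain ⟨hpX, h1, h2, h3⟩ := mem_filter.1 hp
        exact ⟨h1, h2, h3, (hcell p hpX).2.2⟩)
  have hrimB : ((X.filter fun s => -(R₀ + 1) - 1 - 1 ≤ s 2 ∧ s 2 < -(R₀ + 1) - 1 ∧
      (ρ - 1 - 1) ^ 2 < s 0 ^ 2 + s 1 ^ 2).card : ℝ) ≤ 144 * ρ :=
    card_band_annulus₂_le _ (hsepX _ (filter_subset _ _)) (-(R₀ + 1) - 1 - 1) ρ (by linarith)
      (fun p hp => by
        obtain ⟨hpX, h1, h2, h3⟩ := mem_filter.1 hp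
        exact ⟨h1, by linarith, h3, (hcell p hpX).2.2⟩)
  have hrim₁ : ((X.filter fun s => -(R₀ + 1) - 1 - 1 ≤ s 2 ∧ s 2 ≤ -(R₀ + 1) - 1 ∧
      (ρ - 1 - 2) ^ 2 < s 0 ^ 2 + s 1 ^ 2).card : ℝ) ≤ 180 * ρ :=
    card_band_annulus₃_le _ (hsepX _ (filter_subset _ _)) (-(R₀ + 1) - 1 - 1) ρ (by linarith)
      (fun p hp => by
        obtain ⟨hpX, h1, h2, h3⟩ := mem_filter.1 hp
        exact ⟨h1, by linarith, h3, (hcell p hpX).2.2⟩)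
  have hrim₂ : ((X.filter fun s => h + (R₀ + 1) + 1 < s 2 ∧ s 2 ≤ h + (R₀ + 1) + 1 + 1 ∧
      (ρ - 1 - 1) ^ 2 < s 0 ^ 2 + s 1 ^ 2).card : ℝ) ≤ 144 * ρ :=
    card_band_annulus₂_le _ (hsepX _ (filter_subset _ _)) (h + (R₀ + 1) + 1) ρ (by linarith)
      (fun p hp => by
        obtain ⟨hpX, h1, h2, h3⟩ := mem_filter.1 hp
        exact ⟨h1.le, h2, h3, (hcell p hpX).2.2⟩)
  have hRT₁ : ((inPlaneRoots Fr 1).card : ℝ) ≤ 12 := by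
    have : (inPlaneRoots Fr 1).card ≤ 12 := (card_le_card (filter_subset _ _)).trans (by rw [card_fccSlots])
    exact_mod_cast this
  have hRT₂ : ((inPlaneRoots G₂ (-1)).card : ℝ) ≤ 12 := by
    have : (inPlaneRoots G₂ (-1)).card ≤ 12 := (card_le_card (filter_subset _ _)).trans (by rw [card_fccSlots])
    exact_mod_cast this
  have hprod : ∀ a b c : ℝ, 0 ≤ a → a ≤ 12 → 0 ≤ b → b ≤ 180 * ρ → 0 ≤ c → c ≤ 144 * ρ → a * (220 * b + 220 * c) ≤ 855360 * ρ := by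
    intro a b c ha ha' hb hb' hc hc'
    nlinarith
  have hrims₁ := hprod _ _ _ (Nat.cast_nonneg _) hRT₁ (Nat.cast_nonneg _) hrimT (Nat.cast_nonneg _) hrimB
  have hrims₂ := hprod _ _ _ (Nat.cast_nonneg _) hRT₂ (Nat.cast_nonneg _) hrim₁ (Nat.cast_nonneg _) hrim₂
  linarith only [hflux, hmono, hrims₁, hrims₂]

end Summit.Ventures.Crystal3D.Theorems

end
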